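import Summits.AnomalousDissipation.AnomalousDissipation.Theorems.MomentParityQuarticGateAssembly
import Summits.AnomalousDissipation.AnomalousDissipation.Theorems.MomentParityQuarticGateSlater
import Summits.AnomalousDissipation.AnomalousDissipation.Theorems.MomentParityQuarticGateBudget
import Summits.AnomalousDissipation.AnomalousDissipation.Theorems.MomentParityQuarticGateRowPoly
import Summits.AnomalousDissipation.AnomalousDissipation.Theorems.MomentParityQuarticGateDefectCertificate
import Summits.AnomalousDissipation.AnomalousDissipation.Theorems.MomentParityQuarticGateSignLemma
import Summits.AnomalousDissipation.AnomalousDissipation.Theorems.MomentParityQuarticGateSurgery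
import Summits.AnomalousDissipation.AnomalousDissipation.Theorems.QuarticGate.Negative.LevelOne
import Summits.AnomalousDissipation.AnomalousDissipation.Theses.MomentParity

/-!
# The climbing step `d = 3 → 4` under its two missing hypotheses — support for
# `MomentParity.CubicClimb` (stmt-AnomalousDissipation-14840)

`CubicClimb` (support item r6 of route MomentParity) asks: for EVERY smooth solenoidal mean-zero
force `f`, every `ν_j → 0` and budgets `E, ε > 0`, if at every `j`, for infinitely many levels `N`,
a level-`N` probability law with finite THIRD moments is 3-stationary for Galerkin NS at
`(ν_j, P_N f)` with mean energy `≤ E` and dissipation `≥ ε`, then (for some budgets `E', ε' > 0`)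
the same holds with finite FOURTH moments and 4-stationarity (the `QuarticGate` body).

This file proves the climb from the landed far-atom pipeline of the sibling crux `QuarticGate`
(line `recession-cone`: REALIZE `exists_measure_of_strictlyKPositive` = Fialkow–Nie Thm 1.3,
FATTEN `exists_isStrictlyKPositive_eq_of_degree_le_two`, lambda-positivity
`exists_forall_le_isStrictlyKPositive_shift`, ROW POLYNOMIAL `exists_rowPoly`, the sign lemma
`stub_signLemma` (S1), the defect certificate `stub_defectCertificate` (S3) and the exact far-atom
surgery `stub_surgery` (S4)) under EXACTLY the two extra hypotheses that pipeline consumes and the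
item does not supply:

* (H1) the given 3-stationary law has NONDEGENERATE covariance on `V_N` (a Slater point of the
  degree-4 moment cone is then obtained by keeping its moments of order `≤ 3` and inflating the
  fourth moments — `slaterUpgrade_of_stationary3`; no `QuadRigidity` is needed because the law is
  already 3-stationary, in contrast with `stub_order3Surgery`);
* (H2) `NoCubicCasimir N` holds AT THE SAME LEVEL `N` at which the law is given (the item's
  hypothesis is `∃ᶠ N`, so its levels cannot be intersected with a set of levels that is itself
  only known/conjectured frequently).

Main results:

* `slaterUpgrade_of_stationary3` — (H1) + finite third moments + 3-stationary ⟹ a level-`N` law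
  with finite fourth moments, Slater in degree 4, 3-stationary, SAME mean energy and dissipation.
* `climb_level` — at a level with `NoCubicCasimir N`: the full climb `3 → 4` with the same energy
  and dissipation (`slaterUpgrade_of_stationary3` → S3 → S4).
* `cubicClimb_of_nondegenerate_noCubicCasimir` — the sequence-level statement: the hypothesis of
  `CubicClimb` with (H1) added inside the witness clause and (H2) added inside `∃ᶠ N` implies the
  conclusion of `CubicClimb` verbatim, with `E' = E`, `ε' = ε`;
  `cubicClimb_of_eventually_nondegenerate` — the same with an `∀ᶠ N` hypothesis and
  `∃ᶠ N, NoCubicCasimir N` as a separate input (repair option (1)).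

What this does NOT give: `CubicClimb` as filed. A degenerate 3-stationary law (carried by a proper
affine subspace of `V_N`) has no Slater upgrade with the same moments of order `≤ 2` (and the energy
row `ν·tr(A·Cov) = ⟨f, M₁⟩ − ν⟨A M₁, M₁⟩` forbids adding variance without moving the mean, after
which the linear rows demand a Reynolds stress of prescribed divergence — an unproved all-`N` fact);
(H2) is the conjectural Casimir classification (`∃ᶠ N, NoCubicCasimir N` = stub S2 of `QuarticGate`).
-/

-- `Summit.<Summit>.<Problem>` is the tree's mandated summit-side namespace (CONVENTIONS §2); for this
-- single-conjunct summit the two coincide, so the duplicate is deliberate.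
set_option linter.dupNamespace false

namespace Summit.AnomalousDissipation.AnomalousDissipation.Theorems.MomentParityCubicClimb

open scoped BigOperators InnerProductSpace RealInnerProductSpace ENNReal
open MeasureTheory Filter MvPolynomial Literature.MeasureTheory.Moments
open Literature.Analysis.FunctionSpaces Literature.Analysis.FluidPDE
open Summit.AnomalousDissipation.AnomalousDissipation.Theses.MomentParity
open Summit.AnomalousDissipation.AnomalousDissipation.Theorems.QuarticGate.Negative
open Summit.AnomalousDissipation.AnomalousDissipation.Theorems.MomentParityQuarticGate

variable {N n : ℕ} {b : Fin n → UnitAddTorus (Fin 3) → EuclideanSpace ℝ (Fin 3)}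

/-! ## Coordinate monomials of degree `≤ 3` under a finite third moment -/

/-- A coordinate monomial of degree `≤ 3` is dominated by `1 + ‖u‖³` (`pow_le_one_add_cube` of
`Theorems/CubicParityLoud/Negative/EnergyRow.lean`). [folklore] -/
theorem abs_prod_coord_pow_le_three (hb : ∀ i, IsBandTest N (b i))
    (hbo : ∀ i j, ∫ x, ⟪b i x, b j x⟫_ℝ = if i = j then (1 : ℝ) else 0)
    {α : Fin n →₀ ℕ} (hα : (α.sum fun _ e => e) ≤ 3) (u : Torus.energySpace (Fin 3)) :
    |∏ i, (Torus.pairing u.1 (b i)) ^ α i| ≤ 1 + ‖u‖ ^ 3 := by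
  rw [Finset.abs_prod]
  simp_rw [abs_pow]
  have h1 : ∏ i, |Torus.pairing u.1 (b i)| ^ α i ≤ ∏ i, ‖u‖ ^ α i :=
    Finset.prod_le_prod (fun i _ => by positivity) fun i _ =>
      pow_le_pow_left₀ (abs_nonneg _) (abs_coord_le_norm hb hbo u i) _
  refine h1.trans ?_
  rw [Finset.prod_pow_eq_pow_sum]
  refine CubicParityLoud.Negative.pow_le_one_add_cube (norm_nonneg u) ?_
  simpa [Finsupp.sum_fintype] using hα

/-- Coordinate monomials of degree `≤ 3` are integrable against a finite law with `∫ ‖u‖³ < ∞`.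
[folklore] -/
theorem integrable_prod_coord_pow_three (hb : ∀ i, IsBandTest N (b i))
    (hbo : ∀ i j, ∫ x, ⟪b i x, b j x⟫_ℝ = if i = j then (1 : ℝ) else 0)
    {μ : Measure (Torus.energySpace (Fin 3))} [IsFiniteMeasure μ]
    (h3 : Integrable (fun u : Torus.energySpace (Fin 3) => ‖u‖ ^ 3) μ)
    {α : Fin n →₀ ℕ} (hα : (α.sum fun _ e => e) ≤ 3) :
    Integrable (fun u : Torus.energySpace (Fin 3) => ∏ i, (Torus.pairing u.1 (b i)) ^ α i) μ := by
  have hc : Continuous fun u : Torus.energySpace (Fin 3) => ∏ i, (Torus.pairing u.1 (b i)) ^ α i :=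
    continuous_finsetProd _ fun i _ => (Torus.continuous_pairing_coe ((hb i).1.memLp 2)).pow _
  refine Integrable.mono' ((integrable_const (1 : ℝ)).add h3) hc.aestronglyMeasurable
    (ae_of_all _ fun u => ?_)
  rw [Real.norm_eq_abs]
  exact abs_prod_coord_pow_le_three hb hbo hα u

/-- **Integrating a coordinate polynomial of degree `≤ 3`** against a finite law with finite third
moment: `u ↦ Q((u,bᵢ)ᵢ)` is integrable and `∫ Q((u,bᵢ)ᵢ) dμ = L_y(Q)` with `y` the coordinate
moments of `μ` (only `y_α`, `|α| ≤ 3`, enter). [folklore] -/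
theorem integrable_eval_coords_of_three (hb : ∀ i, IsBandTest N (b i))
    (hbo : ∀ i j, ∫ x, ⟪b i x, b j x⟫_ℝ = if i = j then (1 : ℝ) else 0)
    {μ : Measure (Torus.energySpace (Fin 3))} [IsFiniteMeasure μ]
    (h3 : Integrable (fun u : Torus.energySpace (Fin 3) => ‖u‖ ^ 3) μ)
    (Q : MvPolynomial (Fin n) ℝ) (hQ : Q.totalDegree ≤ 3) :
    Integrable (fun u : Torus.energySpace (Fin 3) =>
        MvPolynomial.eval (fun i => Torus.pairing u.1 (b i)) Q) μ ∧
      ∫ u, MvPolynomial.eval (fun i => Torus.pairing u.1 (b i)) Q ∂μ =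
        rieszFunctional (fun α => ∫ u, ∏ i, (Torus.pairing u.1 (b i)) ^ α i ∂μ) Q := by
  have hdeg : ∀ α ∈ Q.support, (α.sum fun _ e => e) ≤ 3 := fun α hα =>
    (MvPolynomial.le_totalDegree hα).trans hQ
  have hfun : (fun u : Torus.energySpace (Fin 3) =>
      MvPolynomial.eval (fun i => Torus.pairing u.1 (b i)) Q) =
      fun u => ∑ α ∈ Q.support, MvPolynomial.coeff α Q * ∏ i, (Torus.pairing u.1 (b i)) ^ α i := by
    funext u
    exact MvPolynomial.eval_eq' _ Q
  have hint : ∀ α ∈ Q.support, Integrable (fun u : Torus.energySpace (Fin 3) =>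
      MvPolynomial.coeff α Q * ∏ i, (Torus.pairing u.1 (b i)) ^ α i) μ :=
    fun α hα => (integrable_prod_coord_pow_three hb hbo h3 (hdeg α hα)).const_mul _
  refine ⟨by rw [hfun]; exact integrable_finsetSum _ hint, ?_⟩
  rw [hfun, integral_finsetSum _ hint]
  unfold rieszFunctional
  refine Finset.sum_congr rfl fun α _ => ?_
  rw [integral_const_mul]

/-! ## Nondegenerate covariance read on the coordinate moments (finite third moment) -/

/-- The nondegenerate-covariance clause, read in an orthonormal band basis for a law with finite
third moment: the coordinate moments `y` have `L_y((ξ·X)²) > L_y(ξ·X)²` for `ξ ≠ 0`. (The bounded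
support version is `rieszFunctional_lt_of_nondegenerate`.) [folklore] -/
theorem rieszFunctional_lt_of_nondegenerate_three (hb : ∀ i, IsBandTest N (b i))
    (hbo : ∀ i j, ∫ x, ⟪b i x, b j x⟫_ℝ = if i = j then (1 : ℝ) else 0)
    (hbs : ∀ u : Torus.energySpace (Fin 3), IsLevel N u →
      ∀ x, Torus.fourierTruncate N (u.1 : UnitAddTorus (Fin 3) → EuclideanSpace ℝ (Fin 3)) x =
        ∑ i, Torus.pairing u.1 (b i) • b i x)
    (μ : Measure (Torus.energySpace (Fin 3))) [IsFiniteMeasure μ]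
    (h3 : Integrable (fun u : Torus.energySpace (Fin 3) => ‖u‖ ^ 3) μ)
    (hnd : ∀ g : UnitAddTorus (Fin 3) → EuclideanSpace ℝ (Fin 3), IsBandTest N g →
      (∃ u : Torus.energySpace (Fin 3), IsLevel N u ∧ Torus.pairing u.1 g ≠ 0) →
      (∫ u, Torus.pairing u.1 g ∂μ) ^ 2 < ∫ u, (Torus.pairing u.1 g) ^ 2 ∂μ)
    (ξ : Fin n → ℝ) (hξ : ξ ≠ 0) :
    (rieszFunctional (fun α => ∫ u, ∏ i, (Torus.pairing u.1 (b i)) ^ α i ∂μ) (∑ i, ξ i • X i)) ^ 2 <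
      rieszFunctional (fun α => ∫ u, ∏ i, (Torus.pairing u.1 (b i)) ^ α i ∂μ)
        ((∑ i, ξ i • X i) ^ 2) := by
  have hband : IsBandTest N (fun x => ∑ i, ξ i • b i x) := sum_smul_band Finset.univ ξ hb
  have hlin : ∀ u : Torus.energySpace (Fin 3),
      Torus.pairing u.1 (fun x => ∑ i, ξ i • b i x) = ∑ i, ξ i * Torus.pairing u.1 (b i) := by
    intro u
    rw [pairing_band_eq_sum hb hbs hband u]
    simp_rw [integral_inner_sum_smul_left hb hbo ξ]
  have heval : ∀ u : Torus.energySpace (Fin 3),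
      eval (fun i => Torus.pairing u.1 (b i)) (∑ i, ξ i • (X i : MvPolynomial (Fin n) ℝ)) =
        Torus.pairing u.1 (fun x => ∑ i, ξ i • b i x) := fun u => by
    rw [hlin, map_sum]
    simp [smul_eval]
  have hex : ∃ u : Torus.energySpace (Fin 3), IsLevel N u ∧
      Torus.pairing u.1 (fun x => ∑ i, ξ i • b i x) ≠ 0 := by
    obtain ⟨u, hu, hux, -⟩ := exists_level_of_coords hb hbo ξ
    refine ⟨u, hu, ?_⟩
    rw [hlin]
    have hpos : 0 < ∑ i, ξ i * ξ i := by
      obtain ⟨i, hi⟩ : ∃ i, ξ i ≠ 0 := by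
        by_contra hall
        push Not at hall
        exact hξ (funext hall)
      exact lt_of_lt_of_le (mul_self_pos.mpr hi)
        (Finset.single_le_sum (fun j _ => mul_self_nonneg (ξ j)) (Finset.mem_univ i))
    have hx : ∀ i, Torus.pairing u.1 (b i) = ξ i := fun i => congr_fun hux i
    simp_rw [hx]
    exact hpos.ne'
  have key := hnd _ hband hex
  have h1 : (∑ i, ξ i • (X i : MvPolynomial (Fin n) ℝ)).totalDegree ≤ 1 :=
    totalDegree_finsetSum_le fun i _ => (totalDegree_smul_le _ _).trans (totalDegree_X i).le
  have hdeg1 : (∑ i, ξ i • (X i : MvPolynomial (Fin n) ℝ)).totalDegree ≤ 3 := h1.trans (by norm_num)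
  have hdeg2 : ((∑ i, ξ i • (X i : MvPolynomial (Fin n) ℝ)) ^ 2).totalDegree ≤ 3 :=
    (totalDegree_pow _ _).trans (by omega)
  rw [← (integrable_eval_coords_of_three hb hbo h3 _ hdeg1).2,
    ← (integrable_eval_coords_of_three hb hbo h3 _ hdeg2).2]
  simp_rw [map_pow, heval]
  exact key

/-! ## The Slater upgrade of a 3-stationary law (third moments kept, fourth moments inflated) -/

/-- **Slater upgrade of a nondegenerate 3-stationary law.** A level-`N` probability law `μ₀` with
finite third moment and NONDEGENERATE covariance on `V_N` which is 3-stationary for Galerkin NS at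
`(ν, f, N)` is replaced by a level-`N` probability law `μ₁` with finite fourth moments whose
degree-4 Riesz functional is STRICTLY positive on `V_N` (band-form Slater), again 3-stationary,
with the same mean energy and dissipation. Construction in an orthonormal band basis
(`exists_bandBasis`): `y₀` = coordinate moments of `μ₀` (meaningful up to order 3); FATTEN to `y₁`
(strictly positive in every degree, `= y₀` up to order 2 — nondegenerate covariance); restore the
third moments and inflate the fourth, `y = (y₀)_{≤3} ⊕ Λ·(y₁)₄`, strictly positive in degree 4 for
`Λ ≫ 1` (`exists_forall_le_isStrictlyKPositive_shift` with shift `S = y₀ − y₁`); REALIZE `y`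
(Fialkow–Nie). Rows of tests of degree `≤ 2` are integrals of coordinate polynomials of degree `≤ 3`
(`exists_rowPoly`), energy and dissipation of degree `2`: all read on `y = y₀`, i.e. on `μ₀`.
No Casimir input is used. [folklore] -/
theorem slaterUpgrade_of_stationary3 (ν : ℝ) {f : UnitAddTorus (Fin 3) → EuclideanSpace ℝ (Fin 3)}
    (hf : Torus.IsSmooth f) (N : ℕ) (μ₀ : Measure (Torus.energySpace (Fin 3)))
    [IsProbabilityMeasure μ₀] (hl₀ : ∀ᵐ u ∂μ₀, IsLevel N u)
    (h3 : Integrable (fun u : Torus.energySpace (Fin 3) => ‖u‖ ^ 3) μ₀)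
    (hnd : ∀ g : UnitAddTorus (Fin 3) → EuclideanSpace ℝ (Fin 3), IsBandTest N g →
      (∃ u : Torus.energySpace (Fin 3), IsLevel N u ∧ Torus.pairing u.1 g ≠ 0) →
      (∫ u, Torus.pairing u.1 g ∂μ₀) ^ 2 < ∫ u, (Torus.pairing u.1 g) ^ 2 ∂μ₀)
    (hst : IsPolyStationary ν f N 3 μ₀) :
    ∃ μ₁ : Measure (Torus.energySpace (Fin 3)), IsProbabilityMeasure μ₁ ∧ (∀ᵐ u ∂μ₁, IsLevel N u) ∧
      Integrable (fun u : Torus.energySpace (Fin 3) => ‖u‖ ^ 4) μ₁ ∧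
      (∀ (m : ℕ) (g : Fin m → UnitAddTorus (Fin 3) → EuclideanSpace ℝ (Fin 3))
        (P : MvPolynomial (Fin m) ℝ), (∀ i, IsBandTest N (g i)) → P.totalDegree ≤ 4 →
        (∀ u : Torus.energySpace (Fin 3), IsLevel N u →
          0 ≤ MvPolynomial.eval (fun j => Torus.pairing u.1 (g j)) P) →
        (∃ u : Torus.energySpace (Fin 3), IsLevel N u ∧
          MvPolynomial.eval (fun j => Torus.pairing u.1 (g j)) P ≠ 0) →
        0 < ∫ u, MvPolynomial.eval (fun j => Torus.pairing u.1 (g j)) P ∂μ₁) ∧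
      IsPolyStationary ν f N 3 μ₁ ∧
      Torus.ensembleEnergy μ₁ = Torus.ensembleEnergy μ₀ ∧
      Torus.ensembleDissipation ν μ₁ = Torus.ensembleDissipation ν μ₀ := by
  classical
  obtain ⟨n, b, hb, hbo, hbs⟩ := exists_bandBasis N
  -- (0) coordinate moments of `μ₀` up to order 3
  set y₀ : (Fin n →₀ ℕ) → ℝ := fun α => ∫ u, ∏ i, (Torus.pairing u.1 (b i)) ^ α i ∂μ₀ with hy₀
  have hmom : ∀ Q : MvPolynomial (Fin n) ℝ, Q.totalDegree ≤ 3 →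
      Integrable (fun u : Torus.energySpace (Fin 3) => eval (fun i => Torus.pairing u.1 (b i)) Q) μ₀ ∧
      ∫ u, eval (fun i => Torus.pairing u.1 (b i)) Q ∂μ₀ = rieszFunctional y₀ Q := fun Q hQ =>
    integrable_eval_coords_of_three hb hbo h3 Q hQ
  have hy₀0 : y₀ 0 = 1 := by simp [hy₀]
  -- (1) fatten (nondegenerate covariance)
  have hpd : ∀ ξ : Fin n → ℝ, ξ ≠ 0 → (rieszFunctional y₀ (∑ i, ξ i • X i)) ^ 2 <
      rieszFunctional y₀ ((∑ i, ξ i • X i) ^ 2) :=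
    rieszFunctional_lt_of_nondegenerate_three hb hbo hbs μ₀ h3 hnd
  obtain ⟨y₁, hy₁pos, hy₁eq⟩ := exists_isStrictlyKPositive_eq_of_degree_le_two n y₀ hy₀0 hpd
  -- (2) restore the third moments of `μ₀`, inflate the fourth moments
  set S : (Fin n →₀ ℕ) → ℝ := fun α => y₀ α - y₁ α with hS
  obtain ⟨Λ₀, hΛ⟩ := exists_forall_le_isStrictlyKPositive_shift n y₁ S (hy₁pos 4)
  set y : (Fin n →₀ ℕ) → ℝ := fun α =>
    if α.degree ≤ 2 then y₁ α else if α.degree = 3 then y₁ α + S α else Λ₀ * y₁ α with hy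
  have hypos : IsStrictlyKPositive (Set.univ : Set (Fin n → ℝ)) 4 y := hΛ Λ₀ le_rfl
  have hyeq : ∀ α : Fin n →₀ ℕ, α.degree ≤ 3 → y α = y₀ α := by
    intro α hα
    by_cases h2 : α.degree ≤ 2
    · simp [hy, h2, hy₁eq α h2]
    · have h3' : α.degree = 3 := by omega
      simp [hy, h3', hS]
  have hy0 : y 0 = 1 := by rw [hyeq 0 (by simp), hy₀0]
  -- (3) realize
  obtain ⟨μ₁, hp₁, hl₁, hi₁, hint⟩ := exists_measure_of_strictlyKPositive hb hbo y hy0 hypos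
  -- transfer of coordinate polynomials of degree `≤ 3`
  have htr : ∀ Q : MvPolynomial (Fin n) ℝ, Q.totalDegree ≤ 3 →
      ∫ u, eval (fun i => Torus.pairing u.1 (b i)) Q ∂μ₁ =
        ∫ u, eval (fun i => Torus.pairing u.1 (b i)) Q ∂μ₀ := by
    intro Q hQ
    rw [(hint Q (hQ.trans (by norm_num))).2, (hmom Q hQ).2]
    exact rieszFunctional_congr_of_totalDegree_le (k := 3) hyeq hQ
  -- band tests in coordinates
  have hpb : ∀ g : UnitAddTorus (Fin 3) → EuclideanSpace ℝ (Fin 3), IsBandTest N g →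
      ∀ u : Torus.energySpace (Fin 3),
        Torus.pairing u.1 g = ∑ i, (∫ y, ⟪g y, b i y⟫_ℝ) * Torus.pairing u.1 (b i) :=
    fun g hg u => pairing_band_eq_sum hb hbs hg u
  refine ⟨μ₁, hp₁, hl₁, hi₁, ?_, ?_, ?_, ?_⟩
  · -- SLATER in degree 4, band form
    intro m g P hg hP4 hnn hex
    have hev : ∀ u : Torus.energySpace (Fin 3), eval (fun j => Torus.pairing u.1 (g j)) P =
        eval (fun i => Torus.pairing u.1 (b i))
          (bind₁ (fun j => ∑ i, C (∫ y, ⟪g j y, b i y⟫_ℝ) * (X i : MvPolynomial (Fin n) ℝ)) P) :=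
      fun u => eval_pairing_transport (fun j i => ∫ y, ⟪g j y, b i y⟫_ℝ) (fun u j => hpb _ (hg j) u) P u
    set P' := bind₁ (fun j => ∑ i, C (∫ y, ⟪g j y, b i y⟫_ℝ) * (X i : MvPolynomial (Fin n) ℝ)) P
      with hP'
    have hdeg : P'.totalDegree ≤ 4 := (totalDegree_bind₁_linear_le _ P).trans hP4
    have hpos : 0 < rieszFunctional y P' := by
      refine hypos.2 P' hdeg (fun x _ => ?_) ?_
      · obtain ⟨u, hu, hux, -⟩ := exists_level_of_coords hb hbo x
        rw [← hux, ← hev u]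
        exact hnn u hu
      · obtain ⟨u, hu, hne⟩ := hex
        exact ⟨_, Set.mem_univ _, by rw [← hev u]; exact hne⟩
    simp_rw [hev]
    rw [(hint P' hdeg).2]
    exact hpos
  · -- 3-STATIONARITY: the row of a test of degree `≤ 2` is a coordinate polynomial of degree `≤ 3`
    intro m g P hg hP
    obtain ⟨Q, hQdeg, hQrow, -⟩ := exists_rowPoly hb hbo hbs ν f hf m g hg P 2 (by omega)
    refine ⟨(hint Q (hQdeg.trans (by norm_num))).1.congr (hl₁.mono fun u hu => (hQrow u hu).symm), ?_⟩
    have h₀ := (hst m g P hg hP).2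
    unfold polyGrad at h₀ ⊢
    rw [integral_congr_ae (hl₁.mono fun u hu => hQrow u hu), htr Q hQdeg,
      ← integral_congr_ae (hl₀.mono fun u hu => hQrow u hu)]
    exact h₀
  · -- ENERGY
    have hev : ∀ u : Torus.energySpace (Fin 3), IsLevel N u →
        ‖u‖ ^ 2 = eval (fun i => Torus.pairing u.1 (b i)) (∑ i, (X i : MvPolynomial (Fin n) ℝ) ^ 2) :=
      fun u hu => by rw [norm_sq_eq_sum_sq_coords hb hbo hbs u hu]; simp [map_sum]
    unfold Torus.ensembleEnergy
    rw [integral_congr_ae (hl₁.mono fun u hu => hev u hu),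
      integral_congr_ae (hl₀.mono fun u hu => hev u hu)]
    exact htr _ ((totalDegree_sum_X_sq_le n).trans (by norm_num))
  · -- DISSIPATION
    obtain ⟨D, hDh, hD⟩ := exists_dissipationPoly hb hbo hbs
    rw [ensembleDissipation_eq_integral_eval hD ν hl₁, ensembleDissipation_eq_integral_eval hD ν hl₀,
      htr D (hDh.totalDegree_le.trans (by norm_num))]

/-! ## The climb at one level without cubic Casimirs -/

/-- **The climbing step `3 → 4` at a level without cubic Casimirs.** At a level `N` with
`NoCubicCasimir N`, a level-`N` probability law with finite third moment and nondegenerate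
covariance which is 3-stationary for Galerkin NS at `(ν, f, N)` yields a level-`N` probability law
with finite fourth moments which is 4-STATIONARY, with the same mean energy and dissipation:
Slater upgrade (`slaterUpgrade_of_stationary3`), defect certificate (S3 `stub_defectCertificate`
fed with the sign lemma S1 `stub_signLemma` and `NoCubicCasimir N`), exact far-atom surgery (S4
`stub_surgery`). [folklore] -/
theorem climb_level {N : ℕ} (hCas : NoCubicCasimir N) (ν : ℝ)
    {f : UnitAddTorus (Fin 3) → EuclideanSpace ℝ (Fin 3)} (hf : Torus.IsSmooth f)
    (μ₀ : Measure (Torus.energySpace (Fin 3))) [IsProbabilityMeasure μ₀]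
    (hl₀ : ∀ᵐ u ∂μ₀, IsLevel N u)
    (h3 : Integrable (fun u : Torus.energySpace (Fin 3) => ‖u‖ ^ 3) μ₀)
    (hnd : ∀ g : UnitAddTorus (Fin 3) → EuclideanSpace ℝ (Fin 3), IsBandTest N g →
      (∃ u : Torus.energySpace (Fin 3), IsLevel N u ∧ Torus.pairing u.1 g ≠ 0) →
      (∫ u, Torus.pairing u.1 g ∂μ₀) ^ 2 < ∫ u, (Torus.pairing u.1 g) ^ 2 ∂μ₀)
    (hst : IsPolyStationary ν f N 3 μ₀) :
    ∃ μ : Measure (Torus.energySpace (Fin 3)), IsProbabilityMeasure μ ∧ (∀ᵐ u ∂μ, IsLevel N u) ∧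
      Integrable (fun u : Torus.energySpace (Fin 3) => ‖u‖ ^ 4) μ ∧ IsPolyStationary ν f N 4 μ ∧
      Torus.ensembleEnergy μ = Torus.ensembleEnergy μ₀ ∧
      Torus.ensembleDissipation ν μ = Torus.ensembleDissipation ν μ₀ := by
  obtain ⟨μ₁, hp₁, hl₁, hi₁, hsl₁, hst₁, hE₁, hD₁⟩ :=
    slaterUpgrade_of_stationary3 ν hf N μ₀ hl₀ h3 hnd hst
  obtain ⟨M, v, c, hcert⟩ := stub_defectCertificate stub_signLemma N hCas ν f hf μ₁ hp₁ hl₁ hi₁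
  obtain ⟨μ, hp, hl, hi, hst4, hE, hD⟩ := stub_surgery ν f N μ₁ hf hp₁ hl₁ hi₁ hsl₁ hst₁ M v c hcert
  exact ⟨μ, hp, hl, hi, hst4, hE.trans hE₁, hD.trans hD₁⟩

/-! ## The sequence-level statement -/

/-- **`CubicClimb` under its two missing hypotheses.** The hypothesis of `CubicClimb` with, inside
each witness clause, NONDEGENERATE covariance on `V_N` and, inside `∃ᶠ N`, `NoCubicCasimir N` at the
same level, implies the conclusion of `CubicClimb` — here through the vocabulary
`IsQuarticWitness` of `Theorems/QuarticGate/Negative/LevelCeiling.lean` — with the SAME budgets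
`E' = E`, `ε' = ε` (`Filter.Frequently.mono` over `climb_level`). The force clauses
`IsDivFree f`, `HasZeroMean f`, `0 < ν j`, `ν → 0` are carried only to match the item. [folklore] -/
theorem cubicClimb_of_nondegenerate_noCubicCasimir :
    ∀ f : UnitAddTorus (Fin 3) → EuclideanSpace ℝ (Fin 3), Torus.IsSmooth f → Torus.IsDivFree f →
    Torus.HasZeroMean f → ∀ (ν : ℕ → ℝ) (E ε : ℝ), (∀ j, 0 < ν j) → Tendsto ν atTop (nhds 0) →
    0 < ε →
    (∀ j : ℕ, ∃ᶠ N in atTop, NoCubicCasimir N ∧ ∃ μ : Measure (Torus.energySpace (Fin 3)),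
      IsProbabilityMeasure μ ∧ (∀ᵐ u ∂μ, IsLevel N u) ∧
      Integrable (fun u : Torus.energySpace (Fin 3) => ‖u‖ ^ 3) μ ∧
      (∀ g : UnitAddTorus (Fin 3) → EuclideanSpace ℝ (Fin 3), IsBandTest N g →
        (∃ u : Torus.energySpace (Fin 3), IsLevel N u ∧ Torus.pairing u.1 g ≠ 0) →
        (∫ u, Torus.pairing u.1 g ∂μ) ^ 2 < ∫ u, (Torus.pairing u.1 g) ^ 2 ∂μ) ∧
      IsPolyStationary (ν j) f N 3 μ ∧
      Torus.ensembleEnergy μ ≤ E ∧ ε ≤ Torus.ensembleDissipation (ν j) μ) →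
    ∃ E' ε' : ℝ, 0 < ε' ∧ ∀ j : ℕ, ∃ᶠ N in atTop, ∃ μ : Measure (Torus.energySpace (Fin 3)),
      IsQuarticWitness f (ν j) N E' ε' μ := by
  intro f hf _ _ ν E ε _ _ hε hj
  refine ⟨E, ε, hε, fun j => (hj j).mono ?_⟩
  rintro N ⟨hCas, μ₀, hp₀, hl₀, h3, hnd, hst, hE₀, hD₀⟩
  obtain ⟨μ, hp, hl, hi, hst4, hE, hD⟩ := climb_level hCas (ν j) hf μ₀ hl₀ h3 hnd hst
  refine ⟨μ, hp, hl, hi, hst4, ?_, ?_⟩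
  · rw [hE]; exact hE₀
  · rw [hD]; exact hD₀

/-- **`CubicClimb` with an EVENTUALLY hypothesis and the Casimir clause decoupled.** If the
3-stationary nondegenerate witnesses exist at ALL large levels (what `CubicParityLoud` delivers:
`∀ N ≥ N₀(ν)`) and level-`N` Galerkin–Euler has no cubic Casimir for FREQUENTLY many `N` (stub S2
of the `QuarticGate` lines, as a hypothesis), the conclusion of `CubicClimb` follows with `E' = E`,
`ε' = ε` (`Filter.Frequently.and_eventually`). This is repair option (1) of the item: strengthen
`∃ᶠ N` to `∀ᶠ N` in the hypothesis. [folklore] -/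
theorem cubicClimb_of_eventually_nondegenerate (hS2 : ∃ᶠ N in atTop, NoCubicCasimir N) :
    ∀ f : UnitAddTorus (Fin 3) → EuclideanSpace ℝ (Fin 3), Torus.IsSmooth f → Torus.IsDivFree f →
    Torus.HasZeroMean f → ∀ (ν : ℕ → ℝ) (E ε : ℝ), (∀ j, 0 < ν j) → Tendsto ν atTop (nhds 0) →
    0 < ε →
    (∀ j : ℕ, ∀ᶠ N in atTop, ∃ μ : Measure (Torus.energySpace (Fin 3)),
      IsProbabilityMeasure μ ∧ (∀ᵐ u ∂μ, IsLevel N u) ∧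
      Integrable (fun u : Torus.energySpace (Fin 3) => ‖u‖ ^ 3) μ ∧
      (∀ g : UnitAddTorus (Fin 3) → EuclideanSpace ℝ (Fin 3), IsBandTest N g →
        (∃ u : Torus.energySpace (Fin 3), IsLevel N u ∧ Torus.pairing u.1 g ≠ 0) →
        (∫ u, Torus.pairing u.1 g ∂μ) ^ 2 < ∫ u, (Torus.pairing u.1 g) ^ 2 ∂μ) ∧
      IsPolyStationary (ν j) f N 3 μ ∧
      Torus.ensembleEnergy μ ≤ E ∧ ε ≤ Torus.ensembleDissipation (ν j) μ) →
    ∃ E' ε' : ℝ, 0 < ε' ∧ ∀ j : ℕ, ∃ᶠ N in atTop, ∃ μ : Measure (Torus.energySpace (Fin 3)),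
      IsQuarticWitness f (ν j) N E' ε' μ := by
  intro f hf hfd hfz ν E ε hν hν0 hε hj
  refine cubicClimb_of_nondegenerate_noCubicCasimir f hf hfd hfz ν E ε hν hν0 hε fun j => ?_
  exact (hS2.and_eventually (hj j)).mono fun N hN => ⟨hN.1, hN.2⟩

/-- **The same, with hypothesis and conclusion spelled as in the route file.** The hypothesis is
the hypothesis of `MomentParity.CubicClimb` VERBATIM with two conjuncts added (`NoCubicCasimir N`
after `∃ᶠ N in atTop`, and the nondegenerate-covariance clause after the third-moment clause); the
conclusion is the conclusion of `MomentParity.CubicClimb` VERBATIM. (Definitional unfolding of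
`cubicClimb_of_nondegenerate_noCubicCasimir`.) [folklore] -/
theorem cubicClimb_of_nondegenerate_noCubicCasimir_verbatim :
    ∀ f : UnitAddTorus (Fin 3) → EuclideanSpace ℝ (Fin 3), Literature.Analysis.FunctionSpaces.Torus.IsSmooth f → Literature.Analysis.FunctionSpaces.Torus.IsDivFree f → Literature.Analysis.FunctionSpaces.Torus.HasZeroMean f → ∀ (ν : ℕ → ℝ) (E ε : ℝ), (∀ j, 0 < ν j) → Filter.Tendsto ν Filter.atTop (nhds 0) → 0 < ε → (∀ j : ℕ, ∃ᶠ N in Filter.atTop, NoCubicCasimir N ∧ ∃ μ : MeasureTheory.Measure (Literature.Analysis.FunctionSpaces.Torus.energySpace (Fin 3)), MeasureTheory.IsProbabilityMeasure μ ∧ (∀ᵐ (u : Literature.Analysis.FunctionSpaces.Torus.energySpace (Fin 3)) ∂μ, (∀ k ∉ (Literature.Analysis.FunctionSpaces.Torus.freqBall N).erase (0 : Fin 3 → ℤ), UnitAddTorus.mFourierCoeff (Literature.Analysis.FunctionSpaces.EuclideanSpace.complexify ∘ (u.1 : UnitAddTorus (Fin 3) → EuclideanSpace ℝ (Fin 3)))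 k = 0)) ∧ MeasureTheory.Integrable (fun u => ‖u‖ ^ 3) μ ∧ (∀ g : UnitAddTorus (Fin 3) → EuclideanSpace ℝ (Fin 3), (Literature.Analysis.FunctionSpaces.Torus.IsSmooth g ∧ Literature.Analysis.FunctionSpaces.Torus.IsDivFree g ∧ Literature.Analysis.FunctionSpaces.Torus.HasZeroMean g ∧ (∀ k ∉ (Literature.Analysis.FunctionSpaces.Torus.freqBall N).erase (0 : Fin 3 → ℤ), UnitAddTorus.mFourierCoeff (Literature.Analysis.FunctionSpaces.EuclideanSpace.complexify ∘ g) k = 0)) → (∃ u : Literature.Analysis.FunctionSpaces.Torus.energySpace (Fin 3), (∀ k ∉ (Literature.Analysis.FunctionSpaces.Torus.freqBall N).erase (0 : Fin 3 → ℤ), UnitAddTorus.mFourierCoeff (Literature.Analysis.FunctionSpaces.EuclideanSpace.complexify ∘ (u.1 : UnitAddTorus (Fin 3) → EuclideanSpace ℝ (Fin 3))) k = 0) ∧ Literature.Analysis.FluidPDE.Torus.pairing u.1 g ≠ 0) → (∫ u, Literature.Analysis.FluidPDE.Torus.pairing u.1 g ∂μ) ^ 2 < ∫ u, (Literature.Analysis.FluidPDE.Torus.pairing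 u.1 g) ^ 2 ∂μ) ∧ (∀ (m : ℕ) (g : Fin m → UnitAddTorus (Fin 3) → EuclideanSpace ℝ (Fin 3)) (P : MvPolynomial (Fin m) ℝ), (∀ i, (Literature.Analysis.FunctionSpaces.Torus.IsSmooth (g i) ∧ Literature.Analysis.FunctionSpaces.Torus.IsDivFree (g i) ∧ Literature.Analysis.FunctionSpaces.Torus.HasZeroMean (g i) ∧ (∀ k ∉ (Literature.Analysis.FunctionSpaces.Torus.freqBall N).erase (0 : Fin 3 → ℤ), UnitAddTorus.mFourierCoeff (Literature.Analysis.FunctionSpaces.EuclideanSpace.complexify ∘ (g i)) k = 0))) → P.totalDegree + 1 ≤ 3 → MeasureTheory.Integrable (fun u => Literature.Analysis.FluidPDE.Torus.nsGeneratorPairing (ν j) f u (fun x => ∑ i : Fin m, (MvPolynomial.eval (fun j => Literature.Analysis.FluidPDE.Torus.pairing u.1 (g j)) (MvPolynomial.pderiv i P)) • g i x)) μ ∧ ∫ u, Literature.Analysis.FluidPDE.Torus.nsGeneratorPairing (ν j) f u (fun x => ∑ i : Fin m, (MvPolynomial.eval (fun j => Literature.Analysis.FluidPDE.Torus.pairing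 u.1 (g j)) (MvPolynomial.pderiv i P)) • g i x) ∂μ = 0) ∧ Literature.Analysis.FluidPDE.Torus.ensembleEnergy μ ≤ E ∧ ε ≤ Literature.Analysis.FluidPDE.Torus.ensembleDissipation (ν j) μ) → ∃ E' ε' : ℝ, 0 < ε' ∧ ∀ j : ℕ, ∃ᶠ N in Filter.atTop, ∃ μ : MeasureTheory.Measure (Literature.Analysis.FunctionSpaces.Torus.energySpace (Fin 3)), MeasureTheory.IsProbabilityMeasure μ ∧ (∀ᵐ (u : Literature.Analysis.FunctionSpaces.Torus.energySpace (Fin 3)) ∂μ, (∀ k ∉ (Literature.Analysis.FunctionSpaces.Torus.freqBall N).erase (0 : Fin 3 → ℤ), UnitAddTorus.mFourierCoeff (Literature.Analysis.FunctionSpaces.EuclideanSpace.complexify ∘ (u.1 : UnitAddTorus (Fin 3) → EuclideanSpace ℝ (Fin 3))) k = 0)) ∧ MeasureTheory.Integrable (fun u => ‖u‖ ^ 4) μ ∧ (∀ (m : ℕ) (g : Fin m → UnitAddTorus (Fin 3) → EuclideanSpace ℝ (Fin 3)) (P : MvPolynomial (Fin m) ℝ), (∀ i, (Literature.Analysis.FunctionSpaces.Torus.IsSmooth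 (g i) ∧ Literature.Analysis.FunctionSpaces.Torus.IsDivFree (g i) ∧ Literature.Analysis.FunctionSpaces.Torus.HasZeroMean (g i) ∧ (∀ k ∉ (Literature.Analysis.FunctionSpaces.Torus.freqBall N).erase (0 : Fin 3 → ℤ), UnitAddTorus.mFourierCoeff (Literature.Analysis.FunctionSpaces.EuclideanSpace.complexify ∘ (g i)) k = 0))) → P.totalDegree + 1 ≤ 4 → MeasureTheory.Integrable (fun u => Literature.Analysis.FluidPDE.Torus.nsGeneratorPairing (ν j) f u (fun x => ∑ i : Fin m, (MvPolynomial.eval (fun j => Literature.Analysis.FluidPDE.Torus.pairing u.1 (g j)) (MvPolynomial.pderiv i P)) • g i x)) μ ∧ ∫ u, Literature.Analysis.FluidPDE.Torus.nsGeneratorPairing (ν j) f u (fun x => ∑ i : Fin m, (MvPolynomial.eval (fun j => Literature.Analysis.FluidPDE.Torus.pairing u.1 (g j)) (MvPolynomial.pderiv i P)) • g i x) ∂μ = 0) ∧ Literature.Analysis.FluidPDE.Torus.ensembleEnergy μ ≤ E' ∧ ε' ≤ Literature.Analysis.FluidPDE.Torus.ensembleDissipation (ν j) μ :=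
  cubicClimb_of_nondegenerate_noCubicCasimir

end Summit.AnomalousDissipation.AnomalousDissipation.Theorems.MomentParityCubicClimb
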